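import Literature.AlgebraicGeometry.AbelianSchemes.AbelianSchemeOverBase
import Literature.AlgebraicGeometry.Deformation.InvertibleSheafExtensionsFlatSmallExtension
import Literature.AlgebraicGeometry.Deformation.FlatDeformationGlobalFunctions
import Literature.AlgebraicGeometry.Motives.CechClassPushforwardIso
import Literature.AlgebraicGeometry.Modules.UnitCocyclePresented
import Mathlib.RingTheory.Artinian.Module
import Mathlib.AlgebraicGeometry.Noetherian
import HarnessLib

/-!
# `H¹(X′, 𝓘) ≅ H¹(A′_κ, 𝒪)` for the principal small extension `A′_C ⊂ A′_{C′}` of an abelian scheme, compatibly with scalars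
# (Hartshorne, *Deformation Theory*, §6 (6.1) and Thm. 6.4: «`H¹(J ⊗_C 𝒪_X)` with `J ⊗_C 𝒪_X ≅ 𝒪_{X₀}`», assembled)

Layer `Literature/AlgebraicGeometry/AbelianSchemes`, namespace `Literature.AlgebraicGeometry.AbelianSchemes.AbelianSchemeOver`.  THEOREMS
ONLY (no definition, no named fact, no instance, no notation, no `sorry`).  Cell `hodgecm-mathlib` (D-0151), F-3 (M) grandchild line
`Cruxes/HDel/Lines/F3DualAbelianSchemeMc`, (N3′) Artinian tower, inner brick **S-c1** (sheaf form WITH the scalar clause) for the S-e count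
(B-p07 (g20) 2026-08-30 21:07:06Z shape (b), 21:17:26Z ruling; the Čech dictionary S-c2 is a separate generic file) — author B-p03 (g20).
HC_CM is proved only modulo the 7 printed citations until rung 0 closes; nothing here is about HC.

SETTING (as ★ `AbelianSchemeSmallExtensionPicardTorsor`): `A′ := A.baseChange p` over `S′`, a principal small extension `q : C′ ↠ C`
(`ker q = (t₀)`, `t₀𝔪 = 0`, `t₀ ≠ 0`) of local rings (`C′` Artinian) with structure map `c′ : Spec C′ → S′`, the residue field `π₀ : C′ ↠ K`
(`ker π₀ = 𝔪`), the thickening `i : X = A′_C ↪ X′ = A′_{C′}` and the closed fibre `j : X₀ = A′_K ↪ X′` (both whiskerings `A′.X ◁ -`),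
`f : X′ → Spec C′`, `f₀ : X₀ → Spec K` the projections.
* §1 (generic flat small extension) `pushforward_map_comp_flatParamMul_eq` — ★ `Deformation.flatParamMul : j_*𝒪_{X₀} ⟶ 𝓘` (`ȳ ↦ t₀·b`)
  INTERTWINES endomorphisms acting sectionwise as multiplication by `f₀♯(π₀ c)` on `𝒪_{X₀}` and by `f♯c` on `𝓘` (checked on affine opens
  via ★ `idealVal_flatParamMulApp_of_app_eq`; Mathlib `TopCat.Sheaf.hom_ext` on the affine basis);
* §1 `idealVal_flatParamMul_app_of_app_eq` — the value formula `flatParamMul_W(ȳ) = t|_W · b` on ANY open `W` for ANY lift `b`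
  (★ has `W = ⊤` and `W` affine); `flatSmallExtensionIdealCohomologyEquiv_cechToH` — the COCYCLE CLAUSE: `e [y] = [flatParamMul ∘ y]` for
  Čech `1`-cocycles `y` of `𝒪_{X₀}` on `j⁻¹𝒲` (★ `map_cechToH`, ★ `cohomologyPushforwardMap_cechToH`);
  `exists_structureSheafCohomology_addEquiv_idealCohomology_of_flat` — both clauses packaged, the cocycle clause in LIFT form
  («`idealVal x_{ab} = t|·b_{ab}` for lifts `b_{ab}` of `y_{ab}`», no `flatParamMul` in the statement);
* §2 **`exists_structureSheafCohomology_addEquiv_idealCohomology_smallExtension`** — for the abelian scheme there is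
  `e : H¹(X₀, 𝒪_{X₀}) ≃+ H¹(X′, 𝓘)` (★ `Deformation.flatSmallExtensionIdealCohomologyEquiv`; flatness of `A′_{C′} → Spec C′`, `j` a surjective
  closed immersion, the squares `Hi`, `Hj` of ★ S-b §1) with (scalars) `e ∘ H¹(ν) = H¹(μ) ∘ e` for all such `μ`, `ν`, `c ∈ C′`, and (cocycles)
  `e [y] = [x]` whenever `idealVal x_{ab} = t|_{𝒲_a ∩ 𝒲_b} · b_{ab}` for lifts `b_{ab}` of `y_{ab}` ((Mc) lead ruling 2026-08-30 21:29:19Z: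
  «scalars live on cocycles»).
[cite: Hartshorne2010, §6 (6.1) pp. 46–47 and Thm. 6.4 (b) with its proof (pp. 50–51)] [cite: Hartshorne1977, III Lemma 4.4 (PDF p. 277)]

## References
* [Hartshorne2010] R. Hartshorne, *Deformation Theory*, GTM 257 (2010), §6 (6.1) (pp. 46–47), Thm. 6.4 (pp. 50–51).
* [Hartshorne1977] R. Hartshorne, *Algebraic Geometry* (1977), III Lemma 2.10 (p. 209) (cohomology along a closed immersion).
-/

noncomputable section

universe u

open CategoryTheory CategoryTheory.Limits AlgebraicGeometry MonoidalCategory IsLocalRing Opposite TopologicalSpace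

namespace Literature.AlgebraicGeometry.AbelianSchemes

open Literature.AlgebraicGeometry.Motives Literature.AlgebraicGeometry.Modules Literature.AlgebraicGeometry.Deformation

namespace AbelianSchemeOver

/-! ## §1 `flatParamMul : j_*𝒪_{X₀} ⟶ 𝓘` commutes with scalars (generic flat small extension) -/

section Scalars

variable {X X' X₀ : Scheme.{u}} {C' C K : Type u} [CommRing C'] [IsLocalRing C'] [CommRing C] [CommRing K]
  (f : X' ⟶ Spec (.of C')) (hf : Flat f)
  (p : C' →+* C) (hp : Function.Surjective p) (t₀ : C') (hker : RingHom.ker p = Ideal.span {t₀})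
  {i : X ⟶ X'} {g : X ⟶ Spec (.of C)}
  (π₀ : C' →+* K) (hπ₀ : Function.Surjective π₀) (hkπ : RingHom.ker π₀ = maximalIdeal C')
  (htm : ∀ m ∈ maximalIdeal C', t₀ * m = 0) (ht₀ : t₀ ≠ 0)
  {j : X₀ ⟶ X'} {g₀ : X₀ ⟶ Spec (.of K)} (hj₁ : IsClosedImmersion j) (hj₂ : Surjective j)
  (Hi : IsPullback i g f (Spec.map (CommRingCat.ofHom p))) (Hj : IsPullback j g₀ f (Spec.map (CommRingCat.ofHom π₀)))

/-- **`flatParamMul` intertwines multiplication by `f♯c` on `𝓘` with multiplication by `f₀♯(π₀ c)` on `𝒪_{X₀}`**: for endomorphisms `μ`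
of `𝓘` and `ν` of `𝒪_{X₀}` given SECTIONWISE by these multiplications, `j_*ν ≫ flatParamMul = flatParamMul ≫ μ` — on an affine open `U`,
`flatParamMul(ȳ) = t₀|_U · b` for ANY lift `b` of `ȳ` (★ `idealVal_flatParamMulApp_of_app_eq`), `(f♯c)|_U · b` lifts `(f₀♯ π₀ c)| · ȳ` (the
square `Hj`), and `t₀ (f♯c) b = (f♯c)(t₀ b)`. [cite: Hartshorne2010, §6 (6.1) pp. 46–47 and Thm. 6.4 (b) (p. 50)] -/
theorem pushforward_map_comp_flatParamMul_eq (c : C') (μ : idealSheafAb i ⟶ idealSheafAb i)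
    (ν : structureSheafAb X₀ ⟶ structureSheafAb X₀)
    (hμ : ∀ (V : X'.Opens) (x : (idealSheafAb i).obj.obj (op V)),
      idealVal i V (μ.hom.app (op V) x) = X'.presheaf.map (homOfLE le_top).op (specStructureMap f c) * idealVal i V x)
    (hν : ∀ (W : X₀.Opens) (y : Γ(X₀, W)),
      ((ν.hom.app (op W)) y : Γ(X₀, W)) =
        (X₀.presheaf.map (homOfLE (le_top : W ≤ ⊤)).op (specStructureMap g₀ (π₀ c)) : Γ(X₀, W)) * y) :
    haveI := hj₁
    (TopCat.Sheaf.pushforward AddCommGrpCat.{u} j.base).map ν ≫ flatParamMul f p t₀ hker π₀ hπ₀ hkπ htm Hi Hj =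
      flatParamMul f p t₀ hker π₀ hπ₀ hkπ htm Hi Hj ≫ μ := by
  haveI := hj₁
  apply Sheaf.hom_ext
  apply TopCat.Sheaf.hom_ext _ (idealSheafAb i) isBasis_range_affineOpens_val
  intro U
  ext y
  apply idealVal_injective i U.1
  -- both sides, applied to `y ∈ Γ(X₀, j⁻¹U)`
  change idealVal i U.1 ((flatParamMul f p t₀ hker π₀ hπ₀ hkπ htm Hi Hj).hom.app (op U.1) (ν.hom.app (op (j ⁻¹ᵁ U.1)) y)) =
    idealVal i U.1 (μ.hom.app (op U.1) ((flatParamMul f p t₀ hker π₀ hπ₀ hkπ htm Hi Hj).hom.app (op U.1) y))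
  have happ : ∀ z, (flatParamMul f p t₀ hker π₀ hπ₀ hkπ htm Hi Hj).hom.app (op U.1) z =
      flatParamMulApp f p t₀ hker π₀ hπ₀ hkπ htm Hi Hj U z := fun z => by
    rw [flatParamMul_app_affine]; rfl
  rw [happ, happ, hμ]
  -- a lift `b` of `y`; then `(f♯c)|_U · b` lifts `ν y`
  obtain ⟨b, hb⟩ := j.app_surjective U.1 U.2 (y : Γ(X₀, j ⁻¹ᵁ U.1))
  have hres : j.app U.1 (X'.presheaf.map (homOfLE le_top).op (specStructureMap f c)) =
      X₀.presheaf.map (homOfLE le_top).op (specStructureMap g₀ (π₀ c)) := by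
    rw [← appTop_specStructureMap_of_isPullback f Hj c]
    exact Modules.app_secRes j (le_top : U.1 ≤ ⊤) (specStructureMap f c)
  have hb' : j.app U.1 (X'.presheaf.map (homOfLE le_top).op (specStructureMap f c) * b) =
      (ν.hom.app (op (j ⁻¹ᵁ U.1)) y : Γ(X₀, j ⁻¹ᵁ U.1)) := by
    rw [map_mul, hres, hb, hν]
  rw [idealVal_flatParamMulApp_of_app_eq f p t₀ hker π₀ hπ₀ hkπ htm Hi Hj U _ _ hb',
    idealVal_flatParamMulApp_of_app_eq f p t₀ hker π₀ hπ₀ hkπ htm Hi Hj U _ _ hb]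
  ring

/-- **The value of `flatParamMul` on ANY open `W`, for ANY lift**: if `j♯_W b = ȳ` then `flatParamMul_W(ȳ) = t|_W · b` in `Γ(X′, W)`
(★ `idealVal_flatParamMulApp_of_app_eq` on the affine opens `U ⊆ W`, glued by locality of `𝒪_{X′}`; the case `W = ⊤` is ★
`idealVal_flatParamMul_appTop_of_appTop_eq`). [cite: Hartshorne2010, §6 proof of Thm. 6.4, p. 50] [cite: StacksProject, Tag 009V] -/
theorem idealVal_flatParamMul_app_of_app_eq (W : X'.Opens) (y : Γ(X₀, j ⁻¹ᵁ W)) (b : Γ(X', W)) (hb : j.app W b = y) :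
    haveI := hj₁
    idealVal i W (((flatParamMul f p t₀ hker π₀ hπ₀ hkπ htm Hi Hj).hom.app (op W)).hom y) =
      X'.presheaf.map (homOfLE (le_top : W ≤ ⊤)).op (specStructureMap f t₀) * b := by
  haveI := hj₁
  refine TopCat.Sheaf.eq_of_locally_eq' X'.sheaf (fun U : {U : X'.affineOpens // U.1 ≤ W} => (U.1 : X'.Opens)) W
    (fun U => homOfLE U.2) ?_ _ _ fun U => ?_
  · intro x hx
    obtain ⟨U', hU', hxU', hU'W⟩ := Opens.isBasis_iff_nbhd.mp X'.isBasis_affineOpens hx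
    exact Opens.mem_iSup.mpr ⟨⟨⟨U', hU'⟩, hU'W⟩, hxU'⟩
  · change Modules.secRes X' U.2 (idealVal i W _) =
      X'.presheaf.map (homOfLE U.2).op (X'.presheaf.map (homOfLE (le_top : W ≤ ⊤)).op (specStructureMap f t₀) * b)
    rw [secRes_idealVal, map_mul]
    have hnat := congrArg (fun ψ => ψ.hom y)
      ((flatParamMul f p t₀ hker π₀ hπ₀ hkπ htm Hi Hj).hom.naturality (homOfLE U.2).op)
    simp only [AddCommGrpCat.hom_comp, AddMonoidHom.coe_comp, Function.comp_apply] at hnat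
    rw [← hnat, flatParamMul_app_affine]
    show idealVal i U.1.1 (flatParamMulApp f p t₀ hker π₀ hπ₀ hkπ htm Hi Hj U.1 _) = _
    rw [idealVal_flatParamMulApp_of_app_eq f p t₀ hker π₀ hπ₀ hkπ htm Hi Hj U.1 _
        (X'.presheaf.map (homOfLE U.2).op b) ?_]
    · congr 1
      change X'.presheaf.map (homOfLE (le_top : U.1.1 ≤ ⊤)).op (specStructureMap f t₀) = _
      rw [← CommRingCat.comp_apply, ← X'.presheaf.map_comp]
      rfl
    · rw [← CommRingCat.comp_apply, Scheme.Hom.naturality, CommRingCat.comp_apply]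
      change X₀.presheaf.map _ (j.app W b) = _
      rw [hb]
      rfl

include hp ht₀ hj₂ in
/-- **`e` carries the Čech class of `ȳ` to the Čech class of `t₀ · y`** (the COCYCLE CLAUSE of the KS count): for an open cover `𝒲` of
`X′`, a Čech `1`-cocycle `y` of `𝒪_{X₀}` on `j⁻¹𝒲` and the cocycle `x := flatParamMul ∘ y` of `𝓘` on `𝒲`, the equivalence ★
`flatSmallExtensionIdealCohomologyEquiv` maps `[y] ∈ H¹(X₀, 𝒪)` to `[x] ∈ H¹(X′, 𝓘)` — naturality of the Čech comparison map in the
sheaf (★ `map_cechToH`) and under the homeomorphism `j` (★ `cohomologyPushforwardMap_cechToH`).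
[cite: Hartshorne2010, §6 proof of Thm. 6.4, pp. 50–51] [cite: Hartshorne1977, III Lemma 4.4 (PDF p. 277)] -/
theorem flatSmallExtensionIdealCohomologyEquiv_cechToH {ι : Type u} (𝒲 : ι → X'.Opens) (h𝒲 : iSup 𝒲 = ⊤)
    (h𝒲₀ : iSup (fun a => j ⁻¹ᵁ 𝒲 a) = ⊤) (x : cechOneCocycles (idealSheafAb i) 𝒲)
    (y : cechOneCocycles (structureSheafAb X₀) (fun a => j ⁻¹ᵁ 𝒲 a))
    (hxy : haveI := hj₁
      ∀ a b, (x : CechOneCochain (idealSheafAb i) 𝒲) a b =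
        ((flatParamMul f p t₀ hker π₀ hπ₀ hkπ htm Hi Hj).hom.app (op (𝒲 a ⊓ 𝒲 b))).hom
          ((y : CechOneCochain (structureSheafAb X₀) (fun a => j ⁻¹ᵁ 𝒲 a)) a b)) :
    haveI := hf; haveI := hj₁; haveI := hj₂
    flatSmallExtensionIdealCohomologyEquiv f p hp t₀ hker π₀ hπ₀ hkπ htm ht₀ Hi Hj 1
        (cechToH (structureSheafAb X₀) (fun a => j ⁻¹ᵁ 𝒲 a) h𝒲₀ y) =
      cechToH (idealSheafAb i) 𝒲 h𝒲 x := by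
  haveI := hf; haveI := hj₁; haveI := hj₂
  -- `y` IS a cocycle of `j_*𝒪_{X₀}` on `𝒲`
  let y' : cechOneCocycles ((Modules.pushforwardAb (baseIso j)).obj (structureSheafAb X₀)) 𝒲 :=
    ⟨(y : CechOneCochain (structureSheafAb X₀) (fun a => j ⁻¹ᵁ 𝒲 a)), by
      rw [mem_cechOneCocycles_iff]
      intro a b c
      exact (mem_cechOneCocycles_iff _ _ _).1 y.2 a b c⟩
  have hy' : cechOneCocycleOfPushforward (baseIso j) (structureSheafAb X₀) 𝒲 y' = y := Subtype.ext rfl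
  have hx : cechOneCocyclesMap (flatParamMul f p t₀ hker π₀ hπ₀ hkπ htm Hi Hj) 𝒲 y' = x := by
    apply Subtype.ext
    funext a b
    exact (hxy a b).symm
  rw [flatSmallExtensionIdealCohomologyEquiv_apply, flatSmallExtensionIdealIso_inv, cohomologyPushforwardAddEquiv_apply, ← hy']
  change Sheaf.H.map _ 1 (Modules.cohomologyPushforwardMap (baseIso j) (structureSheafAb X₀) 1
      (cechToH (structureSheafAb X₀) (preimageCover (baseIso j) 𝒲) (iSup_preimageCover (baseIso j) 𝒲 h𝒲)
        (cechOneCocycleOfPushforward (baseIso j) (structureSheafAb X₀) 𝒲 y'))) = _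
  rw [cohomologyPushforwardMap_cechToH (baseIso j) (structureSheafAb X₀) 𝒲 h𝒲 y', map_cechToH]
  exact congrArg (cechToH (idealSheafAb i) 𝒲 h𝒲) hx

include hf hp hker hπ₀ hkπ htm ht₀ hj₁ hj₂ Hi Hj in
/-- **`H¹(X₀, 𝒪_{X₀}) ≃ H¹(X′, 𝓘)` intertwining scalars (generic flat principal small extension)**: the additive equivalence ★
`Deformation.flatSmallExtensionIdealCohomologyEquiv` (transport along the homeomorphism `j`, then `H¹` of `j_*𝒪_{X₀} ≅ 𝓘`) satisfies
`e ∘ H¹(ν) = H¹(μ) ∘ e` for endomorphisms `μ`, `ν` acting sectionwise as multiplication by `f♯c`, `f₀♯(π₀ c)` (§1 and naturality of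
`Hⁿ(X₀, –) ≃ Hⁿ(X′, j_* –)`, ★ `cohomologyPushforwardAddEquiv_map`). [cite: Hartshorne2010, §6 (6.1) pp. 46–47 and Thm. 6.4 (b) (pp. 50–51)]
[cite: Hartshorne1977, III Lemma 2.10 (p. 209)] -/
theorem exists_structureSheafCohomology_addEquiv_idealCohomology_of_flat :
    ∃ e : Motives.structureSheafCohomology X₀ 1 ≃+ (idealSheafAb i).H 1,
      (∀ (c : C') (μ : idealSheafAb i ⟶ idealSheafAb i) (ν : structureSheafAb X₀ ⟶ structureSheafAb X₀),
        (∀ (V : X'.Opens) (x : (idealSheafAb i).obj.obj (op V)),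
          idealVal i V (μ.hom.app (op V) x) = X'.presheaf.map (homOfLE le_top).op (specStructureMap f c) * idealVal i V x) →
        (∀ (W : X₀.Opens) (y : Γ(X₀, W)),
          ((ν.hom.app (op W)) y : Γ(X₀, W)) =
            (X₀.presheaf.map (homOfLE (le_top : W ≤ ⊤)).op (specStructureMap g₀ (π₀ c)) : Γ(X₀, W)) * y) →
        ∀ a, e (Sheaf.H.map ν 1 a) = Sheaf.H.map μ 1 (e a)) ∧
      (∀ {ι : Type u} (𝒲 : ι → X'.Opens) (h𝒲 : iSup 𝒲 = ⊤) (h𝒲₀ : iSup (fun a => j ⁻¹ᵁ 𝒲 a) = ⊤)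
        (x : cechOneCocycles (idealSheafAb i) 𝒲) (y : cechOneCocycles (structureSheafAb X₀) (fun a => j ⁻¹ᵁ 𝒲 a)),
        (∀ a b, ∃ bab : Γ(X', 𝒲 a ⊓ 𝒲 b),
          j.app (𝒲 a ⊓ 𝒲 b) bab = (y : CechOneCochain (structureSheafAb X₀) (fun a => j ⁻¹ᵁ 𝒲 a)) a b ∧
          idealVal i (𝒲 a ⊓ 𝒲 b) ((x : CechOneCochain (idealSheafAb i) 𝒲) a b) =
            X'.presheaf.map (homOfLE (le_top : 𝒲 a ⊓ 𝒲 b ≤ ⊤)).op (specStructureMap f t₀) * bab) →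
        e (cechToH (structureSheafAb X₀) (fun a => j ⁻¹ᵁ 𝒲 a) h𝒲₀ y) = cechToH (idealSheafAb i) 𝒲 h𝒲 x) := by
  haveI := hf; haveI := hj₁; haveI := hj₂
  refine ⟨flatSmallExtensionIdealCohomologyEquiv f p hp t₀ hker π₀ hπ₀ hkπ htm ht₀ Hi Hj 1, fun c μ ν hμ hν a => ?_,
    fun 𝒲 h𝒲 h𝒲₀ x y hxy => ?_⟩
  · rw [flatSmallExtensionIdealCohomologyEquiv_apply, flatSmallExtensionIdealCohomologyEquiv_apply, cohomologyPushforwardAddEquiv_map,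
      ← Sheaf.H.map_comp_apply, ← Sheaf.H.map_comp_apply, flatSmallExtensionIdealIso_inv]
    exact congrArg (fun ψ => Sheaf.H.map ψ 1 (cohomologyPushforwardAddEquiv j (structureSheafAb X₀) 1 a))
      (pushforward_map_comp_flatParamMul_eq f p t₀ hker π₀ hπ₀ hkπ htm hj₁ Hi Hj c μ ν hμ hν)
  · refine flatSmallExtensionIdealCohomologyEquiv_cechToH f hf p hp t₀ hker π₀ hπ₀ hkπ htm ht₀ hj₁ hj₂ Hi Hj 𝒲 h𝒲 h𝒲₀ x y
      fun a b => ?_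
    obtain ⟨bab, hb, hx⟩ := hxy a b
    apply idealVal_injective i (𝒲 a ⊓ 𝒲 b)
    rw [hx]
    exact (idealVal_flatParamMul_app_of_app_eq f p t₀ hker π₀ hπ₀ hkπ htm hj₁ Hi Hj (𝒲 a ⊓ 𝒲 b) _ bab hb).symm

end Scalars

/-! ## §2 The abelian-scheme instantiation: `e : H¹(A′_κ, 𝒪) ≃ H¹(𝓘)` intertwining scalars -/

/-- `(B ⊗ T₀).left → (B ⊗ T).left` is the base change of `T₀.left → T.left` along `pr₂` (the tensor product of `Over S′` is the fibre
product). [cite: Hartshorne2010, §6 (6.1), p. 46 (`X' ×_{C'} C`)] -/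
private theorem isPullback_whiskerLeft_left_snd' {S' : Scheme.{u}} (B : Over S') {T₀ T : Over S'} (τ : T₀ ⟶ T) :
    IsPullback (B ◁ τ).left (Limits.pullback.snd B.hom T₀.hom) (Limits.pullback.snd B.hom T.hom) τ.left := by
  refine IsPullback.of_right ?_ (Over.whiskerLeft_left_snd τ) (IsPullback.of_hasPullback B.hom T.hom)
  rw [Over.whiskerLeft_left_fst, Over.w τ]
  exact IsPullback.of_hasPullback B.hom T₀.hom

/-- `Spec K → Spec C′` is surjective for the residue field of an Artinian local ring (one-point spectrum). [folklore] -/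
private theorem surjective_specMap_of_isArtinianRing {C' K : Type u} [CommRing C'] [IsLocalRing C'] [IsArtinianRing C'] [Field K]
    (π₀ : C' →+* K) : Surjective (Spec.map (CommRingCat.ofHom π₀)) := by
  refine ⟨fun x => ⟨IsLocalRing.closedPoint K, ?_⟩⟩
  -- every prime of the Artinian local ring `C′` is the maximal ideal
  apply PrimeSpectrum.ext
  have h1 : (Spec.map (CommRingCat.ofHom π₀) (IsLocalRing.closedPoint K)).asIdeal = maximalIdeal C' := by
    haveI : (Spec.map (CommRingCat.ofHom π₀) (IsLocalRing.closedPoint K)).asIdeal.IsMaximal :=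
      IsArtinianRing.isMaximal_of_isPrime _
    exact IsLocalRing.eq_maximalIdeal inferInstance
  have h2 : x.asIdeal = maximalIdeal C' := by
    haveI : x.asIdeal.IsMaximal := IsArtinianRing.isMaximal_of_isPrime _
    exact IsLocalRing.eq_maximalIdeal inferInstance
  rw [h1, h2]

/-- **S-c1 — `H¹(A′_κ, 𝒪_{A′_κ}) ≃ H¹(A′_{C′}, 𝓘)` INTERTWINING SCALARS** for the principal small extension `A′_C ⊂ A′_{C′}` of the abelian
scheme `A′ = A.baseChange p` (★ `Deformation.flatSmallExtensionIdealCohomologyEquiv` = `Hⁿ(X₀, 𝒪) = Hⁿ(X′, j_*𝒪_{X₀})` (homeomorphism `j`)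
composed with `H¹` of `j_*𝒪_{X₀} ≅ 𝓘`), with the SCALAR clause and the COCYCLE clause (lift form) of §1.  Consumed by S-e's
Kodaira–Spencer count together with the Čech dictionary S-c2. [cite: Hartshorne2010, §6 (6.1) pp. 46–47 and Thm. 6.4 (b) with its proof (pp. 50–51)]
[cite: Hartshorne1977, III Lemma 2.10 (p. 209) and Lemma 4.4 (PDF p. 277)] -/
theorem exists_structureSheafCohomology_addEquiv_idealCohomology_smallExtension :
    ∀ (R : Type) [CommRing R] [IsNoetherianRing R] [Algebra ℚ R] (A : AbelianSchemeOver (Spec (.of R)))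
    {S' : Scheme.{0}} [IsAffine S'] (p : S' ⟶ Spec (.of R)) [IsFinite p] [Etale p] [Surjective p]
    (C' C K : Type) [CommRing C'] [IsLocalRing C'] [IsArtinianRing C'] [CommRing C] [Field K]
    (q : C' →+* C) (_hq : Function.Surjective q) (t₀ : C') (_hker : RingHom.ker q = Ideal.span {t₀})
    (_htm : ∀ m ∈ IsLocalRing.maximalIdeal C', t₀ * m = 0) (_ht₀ : t₀ ≠ 0)
    (π₀ : C' →+* K) (_hπ₀ : Function.Surjective π₀) (_hkπ : RingHom.ker π₀ = IsLocalRing.maximalIdeal C')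
    (c' : Spec (.of C') ⟶ S')
    (ι₀ : Over.mk (Spec.map (CommRingCat.ofHom q) ≫ c') ⟶ Over.mk c') (_hι : ι₀.left = Spec.map (CommRingCat.ofHom q))
    (ικ : Over.mk (Spec.map (CommRingCat.ofHom π₀) ≫ c') ⟶ Over.mk c') (_hικ : ικ.left = Spec.map (CommRingCat.ofHom π₀)),
    ∃ e : Motives.structureSheafCohomology ((A.baseChange p).X ⊗ Over.mk (Spec.map (CommRingCat.ofHom π₀) ≫ c')).left 1 ≃+
        (idealSheafAb ((A.baseChange p).X ◁ ι₀).left).H 1,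
      (∀ (c : C') (μ : idealSheafAb ((A.baseChange p).X ◁ ι₀).left ⟶ idealSheafAb ((A.baseChange p).X ◁ ι₀).left)
        (ν : structureSheafAb ((A.baseChange p).X ⊗ Over.mk (Spec.map (CommRingCat.ofHom π₀) ≫ c')).left ⟶
          structureSheafAb ((A.baseChange p).X ⊗ Over.mk (Spec.map (CommRingCat.ofHom π₀) ≫ c')).left),
        (∀ (V : ((A.baseChange p).X ⊗ Over.mk c').left.Opens) (x : (idealSheafAb ((A.baseChange p).X ◁ ι₀).left).obj.obj (op V)),
          idealVal ((A.baseChange p).X ◁ ι₀).left V (μ.hom.app (op V) x) =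
            ((A.baseChange p).X ⊗ Over.mk c').left.presheaf.map (homOfLE le_top).op
              (specStructureMap (Limits.pullback.snd (A.baseChange p).X.hom c') c) *
              idealVal ((A.baseChange p).X ◁ ι₀).left V x) →
        (∀ (W : ((A.baseChange p).X ⊗ Over.mk (Spec.map (CommRingCat.ofHom π₀) ≫ c')).left.Opens)
          (y : Γ(((A.baseChange p).X ⊗ Over.mk (Spec.map (CommRingCat.ofHom π₀) ≫ c')).left, W)),
          ((ν.hom.app (op W)) y : Γ(((A.baseChange p).X ⊗ Over.mk (Spec.map (CommRingCat.ofHom π₀) ≫ c')).left, W)) =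
            (((A.baseChange p).X ⊗ Over.mk (Spec.map (CommRingCat.ofHom π₀) ≫ c')).left.presheaf.map (homOfLE (le_top : W ≤ ⊤)).op
              (specStructureMap (Limits.pullback.snd (A.baseChange p).X.hom (Spec.map (CommRingCat.ofHom π₀) ≫ c')) (π₀ c)) :
              Γ(((A.baseChange p).X ⊗ Over.mk (Spec.map (CommRingCat.ofHom π₀) ≫ c')).left, W)) * y) →
        ∀ a, e (Sheaf.H.map ν 1 a) = Sheaf.H.map μ 1 (e a)) ∧
      (∀ {ι : Type} (𝒲 : ι → ((A.baseChange p).X ⊗ Over.mk c').left.Opens) (h𝒲 : iSup 𝒲 = ⊤)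
        (h𝒲₀ : iSup (fun a => ((A.baseChange p).X ◁ ικ).left ⁻¹ᵁ 𝒲 a) = ⊤)
        (x : cechOneCocycles (idealSheafAb ((A.baseChange p).X ◁ ι₀).left) 𝒲)
        (y : cechOneCocycles (structureSheafAb ((A.baseChange p).X ⊗ Over.mk (Spec.map (CommRingCat.ofHom π₀) ≫ c')).left)
          (fun a => ((A.baseChange p).X ◁ ικ).left ⁻¹ᵁ 𝒲 a)),
        (∀ a b, ∃ bab : Γ(((A.baseChange p).X ⊗ Over.mk c').left, 𝒲 a ⊓ 𝒲 b),
          ((A.baseChange p).X ◁ ικ).left.app (𝒲 a ⊓ 𝒲 b) bab =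
            (y : CechOneCochain (structureSheafAb ((A.baseChange p).X ⊗ Over.mk (Spec.map (CommRingCat.ofHom π₀) ≫ c')).left)
              (fun a => ((A.baseChange p).X ◁ ικ).left ⁻¹ᵁ 𝒲 a)) a b ∧
          idealVal ((A.baseChange p).X ◁ ι₀).left (𝒲 a ⊓ 𝒲 b)
              ((x : CechOneCochain (idealSheafAb ((A.baseChange p).X ◁ ι₀).left) 𝒲) a b) =
            ((A.baseChange p).X ⊗ Over.mk c').left.presheaf.map (homOfLE (le_top : 𝒲 a ⊓ 𝒲 b ≤ ⊤)).op
              (specStructureMap (Limits.pullback.snd (A.baseChange p).X.hom c') t₀) * bab) →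
        e (cechToH (structureSheafAb ((A.baseChange p).X ⊗ Over.mk (Spec.map (CommRingCat.ofHom π₀) ≫ c')).left)
            (fun a => ((A.baseChange p).X ◁ ικ).left ⁻¹ᵁ 𝒲 a) h𝒲₀ y) =
          cechToH (idealSheafAb ((A.baseChange p).X ◁ ι₀).left) 𝒲 h𝒲 x) := by
  intro R _ _ _ A S' _ p _ _ _ C' C K _ _ _ _ _ q hq t₀ hker htm ht₀ π₀ hπ₀ hkπ c' ι₀ hι ικ hικ
  -- the data of ★ `flatSmallExtensionIdealCohomologyEquiv` for `X′ = A′_{C′}`, `X = A′_C`, `X₀ = A′_K`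
  haveI : Smooth (A.baseChange p).X.hom := (A.baseChange p).isSmooth
  haveI : Flat (A.baseChange p).X.hom := inferInstance
  have hflat : Flat (Limits.pullback.snd (A.baseChange p).X.hom c') := MorphismProperty.pullback_snd (P := @Flat) _ _ inferInstance
  have Hi : IsPullback ((A.baseChange p).X ◁ ι₀).left
      (Limits.pullback.snd (A.baseChange p).X.hom (Spec.map (CommRingCat.ofHom q) ≫ c'))
      (Limits.pullback.snd (A.baseChange p).X.hom c') (Spec.map (CommRingCat.ofHom q)) := by
    have h := isPullback_whiskerLeft_left_snd' (A.baseChange p).X ι₀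
    rw [hι] at h
    exact h
  have Hj : IsPullback ((A.baseChange p).X ◁ ικ).left
      (Limits.pullback.snd (A.baseChange p).X.hom (Spec.map (CommRingCat.ofHom π₀) ≫ c'))
      (Limits.pullback.snd (A.baseChange p).X.hom c') (Spec.map (CommRingCat.ofHom π₀)) := by
    have h := isPullback_whiskerLeft_left_snd' (A.baseChange p).X ικ
    rw [hικ] at h
    exact h
  haveI : IsClosedImmersion (Spec.map (CommRingCat.ofHom π₀)) := IsClosedImmersion.spec_of_surjective _ hπ₀
  haveI : Surjective (Spec.map (CommRingCat.ofHom π₀)) := surjective_specMap_of_isArtinianRing π₀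
  have hjc : IsClosedImmersion ((A.baseChange p).X ◁ ικ).left :=
    MorphismProperty.of_isPullback (P := @IsClosedImmersion) Hj.flip inferInstance
  have hjs : Surjective ((A.baseChange p).X ◁ ικ).left :=
    MorphismProperty.of_isPullback (P := @Surjective) Hj.flip inferInstance
  exact exists_structureSheafCohomology_addEquiv_idealCohomology_of_flat (Limits.pullback.snd (A.baseChange p).X.hom c') hflat q hq
    t₀ hker π₀ hπ₀ hkπ htm ht₀ hjc hjs Hi Hj

end AbelianSchemeOver

end Literature.AlgebraicGeometry.AbelianSchemes

end
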